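import Summits.QuantumAdvantage.QuantumAdvantage.Theorems.HolonomyDialOrbit

/-!
# HolonomyDial — Fibre (cell decomp-qadv, seat lens-2, generation 13; supports item 26531 `ExactnessDial.PolyLossOddU3`)

§H part 2: fibres over a free block (`joinAt`, `blk`, `card_fibre`, `joinAt_comp_mem`), block / window / prefix signs (`bsgn`, `wsgn`, `psgn`, `psgn_add`, `bsgn_joinAt`, `wsgn_eq`, `half_le_card_wsgn`), the fibre-wise Smolensky step `fibre_step` and the block step `step_le`.

Split (≤ 400 lines, part 9/11) of the node file `HOME/decomp-qadv-lens-2/g13/HolonomyDial.lean` (v5, sha256 fb2c0281…,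
farm rc 0, no placeholders); declarations verbatim, namespace `Summit.QuantumAdvantage.QuantumAdvantage.Theorems.HolonomyDial`.
Record: NODE-g13.md.
-/

set_option linter.dupNamespace false

noncomputable section
open scoped Classical

namespace Summit.QuantumAdvantage.QuantumAdvantage.Theorems

open Finset
open Literature.Computability.QuantumComplexity Literature.Computability.QuantumComplexity.RingHLF
open Literature.Computability.MetaComplexity Literature.Computability.MetaComplexity.Smolensky
open Summit.QuantumAdvantage.AdviceFreeQNC0
open Summit.QuantumAdvantage.QuantumAdvantage.Theses (ExactnessDial.PolyLossOddU3 ExactnessDial.NoPerfectOdd3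
  ExactnessDial.NoPerfectConst3 ExactnessDial.MassStep3u ExactnessDial.OddToAll3 ExactnessDial.DPLift3
  ExactnessDial.MultiRingBridge3 ExactnessDial.closes)

namespace HolonomyDial

section AvoidHard

variable {N : ℕ}

/-! ### H5. fibres over a free block, block signs, and the fibre-wise Smolensky step -/

section Fibre

/-- overwrite the block `[s, s+m)` of `ρ` with `w`. -/
def joinAt (s m : ℕ) (ρ : Fin N → Bool) (w : Fin m → Bool) : Fin N → Bool :=
  fun j => if h : s ≤ j.val ∧ j.val < s + m then w ⟨j.val - s, by omega⟩ else ρ j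

/-- the block `[s, s+m)` of `ρ`. -/
def blk (s m : ℕ) (hsm : s + m ≤ N) (ρ : Fin N → Bool) : Fin m → Bool := fun i => ρ ⟨s + i.val, by omega⟩

/-- Ring-game helper `joinAt_of_mem` (lens-2 law package; see the module docstring). -/
theorem joinAt_of_mem {s m : ℕ} (ρ : Fin N → Bool) (w : Fin m → Bool) {j : Fin N}
    (h : s ≤ j.val ∧ j.val < s + m) : joinAt s m ρ w j = w ⟨j.val - s, by omega⟩ := by
  unfold joinAt; rw [dif_pos h]

/-- Ring-game helper `joinAt_of_not` (lens-2 law package; see the module docstring). -/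
theorem joinAt_of_not {s m : ℕ} (ρ : Fin N → Bool) (w : Fin m → Bool) {j : Fin N}
    (h : ¬ (s ≤ j.val ∧ j.val < s + m)) : joinAt s m ρ w j = ρ j := by
  unfold joinAt; rw [dif_neg h]

/-- Ring-game helper `joinAt_blk` (lens-2 law package; see the module docstring). -/
theorem joinAt_blk {s m : ℕ} (hsm : s + m ≤ N) (ρ : Fin N → Bool) (w : Fin m → Bool) :
    joinAt s m (joinAt s m ρ w) (blk s m hsm ρ) = ρ := by
  funext j
  by_cases h : s ≤ j.val ∧ j.val < s + m
  · rw [joinAt_of_mem _ _ h]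
    unfold blk
    congr 1
    ext
    simp only
    omega
  · rw [joinAt_of_not _ _ h, joinAt_of_not _ _ h]

/-- Ring-game helper `blk_joinAt` (lens-2 law package; see the module docstring). -/
theorem blk_joinAt {s m : ℕ} (hsm : s + m ≤ N) (ρ : Fin N → Bool) (w : Fin m → Bool) :
    blk s m hsm (joinAt s m ρ w) = w := by
  funext i
  unfold blk
  rw [joinAt_of_mem _ _ (show s ≤ (⟨s + i.val, by omega⟩ : Fin N).val ∧ (⟨s + i.val, by omega⟩ : Fin N).val < s + m by
    simp only; omega)]
  congr 1
  ext
  simp only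
  omega

/-- Ring-game helper `joinAt_joinAt` (lens-2 law package; see the module docstring). -/
theorem joinAt_joinAt {s m : ℕ} (ρ : Fin N → Bool) (w w' : Fin m → Bool) :
    joinAt s m (joinAt s m ρ w) w' = joinAt s m ρ w' := by
  funext j
  by_cases h : s ≤ j.val ∧ j.val < s + m
  · rw [joinAt_of_mem _ _ h, joinAt_of_mem _ _ h]
  · rw [joinAt_of_not _ _ h, joinAt_of_not _ _ h, joinAt_of_not _ _ h]

/-- **fibre identity**: counting over the cube = summing fibre counts over all `ρ` (each fibre met `2^m` times). -/
theorem card_fibre {s m : ℕ} (hsm : s + m ≤ N) (Q : (Fin N → Bool) → Prop) [DecidablePred Q] :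
    2 ^ m * (univ.filter Q).card =
      ∑ ρ : Fin N → Bool, (univ.filter fun w : Fin m → Bool => Q (joinAt s m ρ w)).card := by
  set Pi := (univ : Finset ((Fin N → Bool) × (Fin m → Bool))).filter fun p => Q (joinAt s m p.1 p.2) with hPi
  have hR : Pi.card = ∑ ρ : Fin N → Bool, (univ.filter fun w : Fin m → Bool => Q (joinAt s m ρ w)).card := by
    rw [hPi, Finset.card_filter, Fintype.sum_prod_type]
    refine Finset.sum_congr rfl fun ρ _ => ?_
    rw [Finset.card_filter]
  have hT : ((univ.filter Q) ×ˢ (univ : Finset (Fin m → Bool))).card = 2 ^ m * (univ.filter Q).card := by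
    rw [Finset.card_product, card_univ]
    simp only [Fintype.card_pi, Fintype.card_bool, prod_const, card_univ, Fintype.card_fin]
    ring
  have inj : ∀ p p' : (Fin N → Bool) × (Fin m → Bool),
      (joinAt s m p.1 p.2, blk s m hsm p.1) = (joinAt s m p'.1 p'.2, blk s m hsm p'.1) → p = p' := by
    intro p p' h
    simp only [Prod.mk.injEq] at h
    obtain ⟨hj, hb⟩ := h
    have e1 : p.1 = p'.1 := by
      rw [← joinAt_blk hsm p.1 p.2, ← joinAt_blk hsm p'.1 p'.2, hj, hb]
    have e2 : p.2 = p'.2 := by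
      rw [← blk_joinAt hsm p.1 p.2, ← blk_joinAt hsm p'.1 p'.2, hj]
    exact Prod.ext e1 e2
  have h1 : Pi.card ≤ ((univ.filter Q) ×ˢ (univ : Finset (Fin m → Bool))).card := by
    refine Finset.card_le_card_of_injOn (fun p => (joinAt s m p.1 p.2, blk s m hsm p.1)) ?_ ?_
    · intro p hp
      rw [Finset.mem_coe, hPi, mem_filter] at hp
      rw [Finset.mem_coe, Finset.mem_product, mem_filter]
      exact ⟨⟨mem_univ _, hp.2⟩, mem_univ _⟩
    · intro p _ p' _ h
      exact inj p p' h
  have h2 : ((univ.filter Q) ×ˢ (univ : Finset (Fin m → Bool))).card ≤ Pi.card := by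
    refine Finset.card_le_card_of_injOn (fun p => (joinAt s m p.1 p.2, blk s m hsm p.1)) ?_ ?_
    · intro p hp
      rw [Finset.mem_coe, Finset.mem_product, mem_filter] at hp
      rw [Finset.mem_coe, hPi, mem_filter]
      refine ⟨mem_univ _, ?_⟩
      show Q (joinAt s m (joinAt s m p.1 p.2) (blk s m hsm p.1))
      rw [joinAt_blk]
      exact hp.1.2
    · intro p _ p' _ h
      exact inj p p' h
  rw [← hT, ← hR]
  omega

/-- composing with the fibre map keeps the degree (in the free block variables). -/
theorem joinAt_comp_mem {s m : ℕ} (ρ : Fin N → Bool) {D : ℕ} {P : CubeFn (ZMod 3) N}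
    (hP : P ∈ lowDeg (ZMod 3) N D) : (fun w => P (joinAt s m ρ w)) ∈ lowDeg (ZMod 3) m D := by
  refine Smolensky.comp_mem_lowDeg_of_coord (F := ZMod 3) (joinAt s m ρ) (fun j => ?_) hP
  by_cases h : s ≤ j.val ∧ j.val < s + m
  · have e : (fun u : Fin m → Bool => if joinAt s m ρ u j = true then (1 : ZMod 3) else 0) =
        mono (ZMod 3) {(⟨j.val - s, by omega⟩ : Fin m)} := by
      funext u; rw [joinAt_of_mem _ _ h, mono_singleton_apply]
    rw [e]; exact mono_mem_lowDeg (by simp)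
  · have e : (fun u : Fin m → Bool => if joinAt s m ρ u j = true then (1 : ZMod 3) else 0) =
        fun _ => if ρ j = true then (1 : ZMod 3) else 0 := by
      funext u; rw [joinAt_of_not _ _ h]
    rw [e]; exact const_mem_lowDeg _ _

/-- block zero-sign `Π_{j ∈ [s, s+m)} (-1)^{[x_j = 0]}`. -/
def bsgn (s m : ℕ) (x : Fin N → Bool) : ZMod 3 :=
  ∏ j : Fin N, (if s ≤ j.val ∧ j.val < s + m ∧ x j = false then (-1 : ZMod 3) else 1)

/-- zero-sign of a window. -/
def wsgn {m : ℕ} (w : Fin m → Bool) : ZMod 3 := ∏ i : Fin m, (if w i = false then (-1 : ZMod 3) else 1)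

/-- prefix zero-sign `(-1)^{zpar x k}`. -/
def psgn (x : Fin N → Bool) (k : ℕ) : ZMod 3 := if zpar x k then -1 else 1

/-- Ring-game helper `psgn_sq` (lens-2 law package; see the module docstring). -/
theorem psgn_sq (x : Fin N → Bool) (k : ℕ) : psgn x k * psgn x k = 1 := by
  unfold psgn; cases zpar x k <;> decide

/-- Ring-game helper `bsgn_sq` (lens-2 law package; see the module docstring). -/
theorem bsgn_sq (s m : ℕ) (x : Fin N → Bool) : bsgn s m x * bsgn s m x = 1 := by
  unfold bsgn; rw [← pow_two, sq_sign_prod]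

/-- Ring-game helper `bsgn_cases` (lens-2 law package; see the module docstring). -/
theorem bsgn_cases (s m : ℕ) (x : Fin N → Bool) : bsgn s m x = 1 ∨ bsgn s m x = -1 := by
  have h := bsgn_sq s m x
  generalize bsgn s m x = v at h
  revert v; decide

/-- prefix signs multiply over blocks. -/
theorem psgn_add (x : Fin N → Bool) (s m : ℕ) : psgn x (s + m) = psgn x s * bsgn s m x := by
  unfold psgn bsgn
  rw [zpar_sign x (s + m), zpar_sign x s, ← Finset.prod_mul_distrib]
  refine Finset.prod_congr rfl fun j _ => ?_
  by_cases hx : x j = false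
  · by_cases h1 : j.val < s
    · rw [if_pos ⟨by omega, hx⟩, if_pos ⟨h1, hx⟩, if_neg (fun h => absurd h.1 (by omega))]; ring
    · by_cases h2 : j.val < s + m
      · rw [if_pos ⟨h2, hx⟩, if_neg (fun h => h1 h.1), if_pos ⟨by omega, h2, hx⟩]; ring
      · rw [if_neg (fun h => h2 h.1), if_neg (fun h => h1 h.1), if_neg (fun h => h2 h.2.1)]; ring
  · rw [if_neg (fun h => hx h.2), if_neg (fun h => hx h.2), if_neg (fun h => hx h.2.2)]; ring

/-- Ring-game helper `psgn_zero` (lens-2 law package; see the module docstring). -/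
theorem psgn_zero (x : Fin N → Bool) : psgn x 0 = 1 := by unfold psgn; rw [zpar_zero]; rfl

/-- Ring-game helper `oddZeros_iff_psgn` (lens-2 law package; see the module docstring). -/
theorem oddZeros_iff_psgn (x : Fin N → Bool) : OddZeros x ↔ psgn x N = -1 := by
  rw [oddZeros_iff_zpar]; unfold psgn; cases zpar x N <;> decide

/-- the block embedding. -/
def embBlk (s m : ℕ) (hsm : s + m ≤ N) : Fin m ↪ Fin N :=
  ⟨fun i => ⟨s + i.val, by omega⟩, fun i i' h => by
    have := congrArg Fin.val h
    simp only at this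
    exact Fin.ext (by omega)⟩

/-- Ring-game helper `filter_blk_eq_map` (lens-2 law package; see the module docstring). -/
theorem filter_blk_eq_map {s m : ℕ} (hsm : s + m ≤ N) :
    (univ : Finset (Fin N)).filter (fun j => s ≤ j.val ∧ j.val < s + m) = (univ : Finset (Fin m)).map (embBlk s m hsm) := by
  ext j
  rw [mem_filter, Finset.mem_map]
  constructor
  · rintro ⟨_, h1, h2⟩
    exact ⟨⟨j.val - s, by omega⟩, mem_univ _, by unfold embBlk; ext; simp only [Function.Embedding.coeFn_mk]; omega⟩
  · rintro ⟨i, _, rfl⟩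
    unfold embBlk
    simp only [Function.Embedding.coeFn_mk, mem_univ, true_and]
    omega

/-- the block sign of a fibre point is the window sign of the free block. -/
theorem bsgn_joinAt {s m : ℕ} (hsm : s + m ≤ N) (ρ : Fin N → Bool) (w : Fin m → Bool) :
    bsgn s m (joinAt s m ρ w) = wsgn w := by
  unfold bsgn wsgn
  have e : ∀ j : Fin N, (if s ≤ j.val ∧ j.val < s + m ∧ joinAt s m ρ w j = false then (-1 : ZMod 3) else 1) =
      if s ≤ j.val ∧ j.val < s + m then (if joinAt s m ρ w j = false then (-1 : ZMod 3) else 1) else 1 := by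
    intro j
    by_cases h : s ≤ j.val ∧ j.val < s + m
    · rw [if_pos h]
      by_cases hx : joinAt s m ρ w j = false
      · rw [if_pos ⟨h.1, h.2, hx⟩, if_pos hx]
      · rw [if_neg (fun h' => hx h'.2.2), if_neg hx]
    · rw [if_neg h, if_neg (fun h' => h ⟨h'.1, h'.2.1⟩)]
  simp_rw [e]
  rw [← Finset.prod_filter, filter_blk_eq_map hsm, Finset.prod_map]
  refine Finset.prod_congr rfl fun i _ => ?_
  have hmem : s ≤ ((embBlk s m hsm) i).val ∧ ((embBlk s m hsm) i).val < s + m := by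
    unfold embBlk; simp only [Function.Embedding.coeFn_mk]; omega
  rw [joinAt_of_mem _ _ hmem]
  have ei : (⟨((embBlk s m hsm) i).val - s, by have := hmem; omega⟩ : Fin m) = i := by
    unfold embBlk; ext; simp only [Function.Embedding.coeFn_mk]; omega
  rw [ei]

/-- a block sign is blind to the other blocks. -/
theorem bsgn_joinAt_of_disjoint {s m s' m' : ℕ} (hd : s' + m' ≤ s ∨ s + m ≤ s') (ρ : Fin N → Bool) (w : Fin m → Bool) :
    bsgn s' m' (joinAt s m ρ w) = bsgn s' m' ρ := by
  unfold bsgn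
  refine Finset.prod_congr rfl fun j _ => ?_
  by_cases h : s' ≤ j.val ∧ j.val < s' + m'
  · rw [joinAt_of_not _ _ (fun h' => by omega)]
  · rw [if_neg (fun h' => h ⟨h'.1, h'.2.1⟩), if_neg (fun h' => h ⟨h'.1, h'.2.1⟩)]

/-- the window sign is Smolensky's order-2 character up to `(-1)^m`. -/
theorem wsgn_eq {m : ℕ} (w : Fin m → Bool) : wsgn w = (-1) ^ m * omMono (2 : ZMod 3) univ w := by
  unfold wsgn omMono
  rw [show ((-1 : ZMod 3)) ^ m = ∏ _i : Fin m, (-1 : ZMod 3) by rw [Finset.prod_const, card_univ, Fintype.card_fin],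
    ← Finset.prod_mul_distrib]
  refine Finset.prod_congr rfl fun i _ => ?_
  cases w i <;> decide

/-- Ring-game helper `wsgn_cases` (lens-2 law package; see the module docstring). -/
theorem wsgn_cases {m : ℕ} (w : Fin m → Bool) : wsgn w = 1 ∨ wsgn w = -1 := by
  have h : wsgn w * wsgn w = 1 := by unfold wsgn; rw [← pow_two, sq_sign_prod]
  generalize wsgn w = v at h
  revert v; decide

/-- both window-sign classes are at least half the cube (`m ≥ 3`). -/
theorem half_le_card_wsgn {m : ℕ} (hm3 : 3 ≤ m) (τ : ZMod 3) (hτ : τ = 1 ∨ τ = -1) :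
    2 ^ (m - 1) ≤ (univ.filter fun w : Fin m → Bool => wsgn w = τ).card := by
  obtain ⟨k, rfl⟩ : ∃ k, m = k + 1 := ⟨m - 1, by omega⟩
  rw [Nat.add_sub_cancel]
  have eodd : (univ.filter fun w : Fin (k + 1) → Bool => wsgn w = -1) = univ.filter fun w => OddZeros w := by
    refine filter_congr fun w _ => ?_
    rw [oddZeros_iff_prod]; rfl
  have hlo : 2 ^ k ≤ (univ.filter fun w : Fin (k + 1) → Bool => wsgn w = -1).card := by
    rw [eodd]; exact Theorems.ExactnessDialOddToAll.two_pow_le_card_odd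
  have hhi : (univ.filter fun w : Fin (k + 1) → Bool => wsgn w = -1).card ≤ 2 ^ k := by
    rw [eodd]; have := card_odd_le (n := k + 1) (by omega); simpa using this
  rcases hτ with rfl | rfl
  · have htot := Finset.card_filter_add_card_filter_not (s := (univ : Finset (Fin (k + 1) → Bool))) (fun w => wsgn w = -1)
    have hc : (univ : Finset (Fin (k + 1) → Bool)).card = 2 ^ (k + 1) := by simp
    rw [hc] at htot
    have e1 : (univ.filter fun w : Fin (k + 1) → Bool => ¬ wsgn w = -1) = univ.filter fun w => wsgn w = 1 := by
      refine filter_congr fun w _ => ?_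
      rcases wsgn_cases w with h | h
      · rw [h]; decide
      · rw [h]; decide
    rw [e1, pow_succ] at htot
    omega
  · exact hlo

/-- **fibre-wise Smolensky step**: on one free odd block, a low-degree event meets both zero-sign classes almost
equally often: `#{G = 1, sign = τ} ≤ #{G = 1, sign = -τ} + 2D·C(m, m/2)`. -/
theorem fibre_step {m D : ℕ} (hm : Odd m) (hm3 : 3 ≤ m) {G : CubeFn (ZMod 3) m} (hG : G ∈ lowDeg (ZMod 3) m D)
    (τ : ZMod 3) (hτ : τ = 1 ∨ τ = -1) :
    (univ.filter fun w => G w = 1 ∧ wsgn w = τ).card ≤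
      (univ.filter fun w => G w = 1 ∧ wsgn w = -τ).card + (D + D) * m.choose (m / 2) := by
  have hH : (τ • (1 + indP G 1) : CubeFn (ZMod 3) m) ∈ lowDeg (ZMod 3) m (D + D) :=
    Submodule.smul_mem _ _ (Submodule.add_mem _ (one_mem_lowDeg _) (indP_mem hG 1))
  have hS : (univ.filter fun w : Fin m → Bool => omMono (2 : ZMod 3) univ w = (τ • (1 + indP G 1) : CubeFn (ZMod 3) m) w).card
      ≤ 2 ^ (m - 1) + (D + D) * m.choose (m / 2) := by
    convert card_filter_omMono_eq_le hm (ω := (2 : ZMod 3)) (by decide) (by decide) hH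
  have key : ∀ w : Fin m → Bool, omMono (2 : ZMod 3) univ w = -wsgn w := by
    intro w; rw [wsgn_eq w, Odd.neg_one_pow hm]; ring
  have hsub : (univ.filter fun w => G w = 1 ∧ wsgn w = τ).card + (univ.filter fun w => ¬ G w = 1 ∧ wsgn w = -τ).card ≤
      (univ.filter fun w : Fin m → Bool => omMono (2 : ZMod 3) univ w = (τ • (1 + indP G 1) : CubeFn (ZMod 3) m) w).card := by
    rw [← Finset.card_union_of_disjoint (Finset.disjoint_filter.2 fun w _ h1 h2 => h2.1 h1.1)]
    refine card_le_card fun w hw => ?_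
    rw [mem_union, mem_filter, mem_filter] at hw
    rw [mem_filter]
    refine ⟨mem_univ _, ?_⟩
    simp only [Pi.smul_apply, Pi.add_apply, Pi.one_apply, indP_apply, smul_eq_mul]
    rcases hw with ⟨_, hG1, hs⟩ | ⟨_, hG1, hs⟩
    · rw [if_pos hG1, key, hs]
      rcases hτ with rfl | rfl <;> decide
    · rw [if_neg hG1, key, hs]; ring
  have hhalf := half_le_card_wsgn hm3 (-τ) (by rcases hτ with rfl | rfl <;> simp)
  have hsplit : (univ.filter fun w : Fin m → Bool => wsgn w = -τ).card ≤
      (univ.filter fun w => G w = 1 ∧ wsgn w = -τ).card + (univ.filter fun w => ¬ G w = 1 ∧ wsgn w = -τ).card := by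
    rw [← Finset.card_union_of_disjoint (Finset.disjoint_filter.2 fun w _ h1 h2 => h2.1 h1.1)]
    refine card_le_card fun w hw => ?_
    rw [mem_filter] at hw
    rw [mem_union, mem_filter, mem_filter]
    by_cases h : G w = 1
    · exact Or.inl ⟨mem_univ _, h, hw.2⟩
    · exact Or.inr ⟨mem_univ _, h, hw.2⟩
  omega

/-- **STEP**: freeing one odd block, a low-degree event split by that block's sign is balanced up to `2^N / K`
(block-blind side condition `R`; `K·2D·C(m,m/2) ≤ 2^m`). -/
theorem step_le {s m D K : ℕ} (hsm : s + m ≤ N) (hm : Odd m) (hm3 : 3 ≤ m)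
    (hK : K * ((D + D) * m.choose (m / 2)) ≤ 2 ^ m)
    {P : CubeFn (ZMod 3) N} (hP : P ∈ lowDeg (ZMod 3) N D)
    (R : (Fin N → Bool) → Prop) [DecidablePred R] (hR : ∀ ρ (w w' : Fin m → Bool), R (joinAt s m ρ w) → R (joinAt s m ρ w'))
    (τ : ZMod 3) (hτ : τ = 1 ∨ τ = -1) :
    K * (univ.filter fun x => P x = 1 ∧ R x ∧ bsgn s m x = τ).card ≤
      K * (univ.filter fun x => P x = 1 ∧ R x ∧ bsgn s m x = -τ).card + 2 ^ N := by
  have hA := card_fibre hsm (fun x => P x = 1 ∧ R x ∧ bsgn s m x = τ)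
  have hB := card_fibre hsm (fun x => P x = 1 ∧ R x ∧ bsgn s m x = -τ)
  have hfib : ∀ ρ : Fin N → Bool,
      (univ.filter fun w : Fin m → Bool =>
          P (joinAt s m ρ w) = 1 ∧ R (joinAt s m ρ w) ∧ bsgn s m (joinAt s m ρ w) = τ).card ≤
      (univ.filter fun w : Fin m → Bool =>
          P (joinAt s m ρ w) = 1 ∧ R (joinAt s m ρ w) ∧ bsgn s m (joinAt s m ρ w) = -τ).card
        + (D + D) * m.choose (m / 2) := by
    intro ρ
    by_cases hRρ : R (joinAt s m ρ (fun _ => false))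
    · have hRall : ∀ w, R (joinAt s m ρ w) := fun w => hR ρ _ _ hRρ
      have hG : (fun w => P (joinAt s m ρ w)) ∈ lowDeg (ZMod 3) m D := joinAt_comp_mem ρ hP
      have h := fibre_step hm hm3 hG τ hτ
      have e1 : (univ.filter fun w : Fin m → Bool =>
            P (joinAt s m ρ w) = 1 ∧ R (joinAt s m ρ w) ∧ bsgn s m (joinAt s m ρ w) = τ) =
          univ.filter fun w => (fun w => P (joinAt s m ρ w)) w = 1 ∧ wsgn w = τ := by
        refine filter_congr fun w _ => ?_
        rw [bsgn_joinAt hsm]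
        exact ⟨fun h => ⟨h.1, h.2.2⟩, fun h => ⟨h.1, hRall w, h.2⟩⟩
      have e2 : (univ.filter fun w : Fin m → Bool =>
            P (joinAt s m ρ w) = 1 ∧ R (joinAt s m ρ w) ∧ bsgn s m (joinAt s m ρ w) = -τ) =
          univ.filter fun w => (fun w => P (joinAt s m ρ w)) w = 1 ∧ wsgn w = -τ := by
        refine filter_congr fun w _ => ?_
        rw [bsgn_joinAt hsm]
        exact ⟨fun h => ⟨h.1, h.2.2⟩, fun h => ⟨h.1, hRall w, h.2⟩⟩
      rw [e1, e2]; exact h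
    · have hRnone : ∀ w, ¬ R (joinAt s m ρ w) := fun w h => hRρ (hR ρ _ _ h)
      have e1 : (univ.filter fun w : Fin m → Bool =>
            P (joinAt s m ρ w) = 1 ∧ R (joinAt s m ρ w) ∧ bsgn s m (joinAt s m ρ w) = τ) = ∅ :=
        filter_eq_empty_iff.2 fun w _ h => hRnone w h.2.1
      rw [e1, card_empty]; exact Nat.zero_le _
  have hsum := Finset.sum_le_sum fun ρ (_ : ρ ∈ (univ : Finset (Fin N → Bool))) => hfib ρ
  rw [Finset.sum_add_distrib, Finset.sum_const, card_univ, smul_eq_mul, ← hA, ← hB] at hsum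
  have hcard : Fintype.card (Fin N → Bool) = 2 ^ N := by simp
  rw [hcard] at hsum
  set A := (univ.filter fun x => P x = 1 ∧ R x ∧ bsgn s m x = τ).card
  set B := (univ.filter fun x => P x = 1 ∧ R x ∧ bsgn s m x = -τ).card
  set c := (D + D) * m.choose (m / 2)
  have e1 : K * (2 ^ m * A) ≤ K * (2 ^ m * B) + 2 ^ N * (K * c) := by
    calc K * (2 ^ m * A) ≤ K * (2 ^ m * B + 2 ^ N * c) := Nat.mul_le_mul_left K hsum
      _ = K * (2 ^ m * B) + 2 ^ N * (K * c) := by ring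
  have e2 : 2 ^ N * (K * c) ≤ 2 ^ N * 2 ^ m := Nat.mul_le_mul_left _ hK
  have e3 : 2 ^ m * (K * A) ≤ 2 ^ m * (K * B + 2 ^ N) := by
    calc 2 ^ m * (K * A) = K * (2 ^ m * A) := by ring
      _ ≤ K * (2 ^ m * B) + 2 ^ N * (K * c) := e1
      _ ≤ K * (2 ^ m * B) + 2 ^ N * 2 ^ m := Nat.add_le_add_left e2 _
      _ = 2 ^ m * (K * B + 2 ^ N) := by ring
  exact Nat.le_of_mul_le_mul_left e3 (Nat.two_pow_pos m)
end Fibre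

end AvoidHard

end HolonomyDial

end Summit.QuantumAdvantage.QuantumAdvantage.Theorems
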